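import Literature.AnabelianGeometry.Anabelioids.ComponentsOrbits
import Literature.AnabelianGeometry.Anabelioids.ComponentPieces
import Literature.AnabelianGeometry.Anabelioids.ConnectedOfEquivalence
import Literature.AnabelianGeometry.Anabelioids.FibrePullbackLemmas
import Literature.AnabelianGeometry.Anabelioids.OverStarExact
import Literature.AnabelianGeometry.SemiGraphs.FiniteEtaleCoveringComp

/-!
# Connected components read back through a local equivalence `(𝒢_v)_{/P} ⥤ 𝒢'_{v'}` ([SemiAnbd] §2, Def. 2.2 (i))

Mochizuki, *Semi-graphs of anabelioids*, Publ. RIMS **42** (2006) 221–322, §2, Definition 2.2 (i),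
author's manuscript p. 23 [cite: MochizukiSemiAnbd2006, Def. 2.2(i) p.23]: the constituent of a finite
étale covering at a vertex over `v` is the component anabelioid `(𝒢_v)_P` of a connected component
`P ⊆ S_v`; for a covering OF the covering, the vertices over such a vertex are in turn "the connected
components" of an object of `(𝒢_v)_P` — which, read back in `𝒢_v`, are connected components of an
object of `𝒢_v` lying over `P` (print, p. 23: a finite étale covering of `B(𝒢)_{G'}` "may also be
regarded as a finite étale covering of `B(𝒢)`").

PROOF-ONLY toolkit (abc-iut cell, layer L3, row «COMP-LOCAL» = the LOCAL clause of a composite of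
finite étale coverings, FACT-LIST F-1478 residual; no definition of a notion, no named fact).  For a
Galois category `C`, an object `P ∈ C`, an equivalence `α : C_{/P} ⥤ D` onto a Galois category (the
local equivalence of a covering at a vertex), an object `Y ∈ C_{/P}` and a monomorphism
`m : Y.left ↪ Z` (the piece `X_v ×_{S_v} P ↪ X_v`):

* `Over.isConnected_left` / `Over.isConnected_of_isConnected_left` — an object of `C_{/P}` is
  connected iff its underlying object is;
* `exists_component_factor`, `component_factor_unique` — a connected subobject `K ⊆ Y` maps, along
  any `g : Y → S`, into exactly one connected component of `S` ("the component under");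
* `readBack α Y K := α⁻¹ K → Y` for a component `K ⊆ α Y`, and `componentIn α Y m K ⊆ Z`, the
  component of `Z` it names: INJECTIVE in `K` (`componentIn_injective`), lying inside `m`
  (`componentIn_le`), and EVERY component of `Z` inside `m` is so named (`exists_componentIn_eq`);
* `exists_sliceEquiv_componentIn` — `(P × −) ⋙ α ⋙ (K × −) ≅ (componentIn K × −) ⋙ E` for an
  equivalence `E : C_{/componentIn K} ⥤ D_{/K}` (iterated slices, `starEquivStarIso` of
  `FiniteEtaleCoveringComp.lean`, and `Over.map` of `componentIn K ≅ (α⁻¹ K).left`) — the constituent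
  clause of the composite covering at such a vertex.

Nothing here takes a side on [IUTchIII] Cor. 3.12.
-/

namespace Literature.AnabelianGeometry.SemiGraphs

open CategoryTheory CategoryTheory.Limits CategoryTheory.PreGaloisCategory
open Literature.AnabelianGeometry.Anabelioids

universe v₁ v₂ u₁ u₂

-- Mathlib's `Over.pullback` / `Over.post` simp lemmas only fire under the pre-v4.2x defeq transparency
-- behaviour, exactly as in `Mathlib/CategoryTheory/Comma/Over/Pullback.lean` (also: `π₀Obj` coercions).
set_option backward.isDefEq.respectTransparency false

/-! ### Connected objects of a slice -/

section OverConnected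

variable {C : Type u₁} [Category.{v₁} C] [GaloisCategory C] {P : C}

/-- An object of `C_{/P}` whose underlying object is initial is initial; conversely (strict initial
objects) an object of `C_{/P}` admitting a morphism to the initial object over `P` has initial
underlying object. [cite: MochizukiSemiAnbd2006, Def. 2.2(i) p.23] -/
theorem Over.isInitial_left_of_isInitial (Y : Over P) (hI : IsInitial Y) : Nonempty (IsInitial Y.left) :=
  isInitial_of_hom_to_initial initialIsInitial (hI.to (Over.mk (initial.to P))).left

/-- An object of `C_{/P}` which is connected (in `C_{/P}`) has connected underlying object: the
forgetful functor detects the initial object and reflects isomorphisms, and a monomorphism into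
`Y.left` is a monomorphism over `P`. [cite: MochizukiSemiAnbd2006, Def. 2.2(i) p.23] -/
theorem Over.isConnected_left (Y : Over P) [h : IsConnected Y] : IsConnected Y.left where
  notInitial hI := h.notInitial (nonempty_isInitial_over_of_left Y hI).some
  noTrivialComponent Z i _ hZ := by
    let i' : Over.mk (i ≫ Y.hom) ⟶ Y := Over.homMk i rfl
    haveI : Mono i' := (Over.forget P).mono_of_mono_map (by change Mono i; infer_instance)
    have hZ' : IsInitial (Over.mk (i ≫ Y.hom)) → False := fun hI =>
      hZ (Over.isInitial_left_of_isInitial _ hI).some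
    haveI : IsIso i' := h.noTrivialComponent _ i' hZ'
    change IsIso ((Over.forget P).map i')
    infer_instance

/-- Conversely an object of `C_{/P}` with connected underlying object is connected in `C_{/P}`.
[cite: MochizukiSemiAnbd2006, Def. 2.2(i) p.23] -/
theorem Over.isConnected_of_isConnected_left (Y : Over P) [h : IsConnected Y.left] :
    IsConnected Y where
  notInitial hI := h.notInitial (Over.isInitial_left_of_isInitial Y hI).some
  noTrivialComponent Z i _ hZ := by
    have hZl : IsInitial Z.left → False := fun hI => hZ (nonempty_isInitial_over_of_left Z hI).some
    haveI : IsIso ((Over.forget P).map i) := h.noTrivialComponent Z.left i.left hZl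
    exact isIso_of_reflects_iso i (Over.forget P)

end OverConnected

/-! ### The component under a morphism -/

section ComponentUnder

variable {C : Type u₁} [Category.{v₁} C] [GaloisCategory C]

/-- **The component under.** A connected subobject `K ⊆ Y` maps, along any `g : Y → S`, into some
connected component `P` of `S` (take a point of the fibre of `K`; its image lies in a component `P`;
then `K ×_S P → K` is a monomorphism with nonempty fibre into a connected object, an isomorphism).
[cite: MochizukiSemiAnbd2006, Def. 2.2(i) p.23] -/
theorem exists_component_factor {Y S : C} (g : Y ⟶ S) (K : π₀Obj Y) :
    ∃ (P : π₀Obj S) (k : (K.1 : C) ⟶ (P.1 : C)), k ≫ P.1.arrow = K.1.arrow ≫ g := by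
  let F := GaloisCategory.getFiberFunctor C
  haveI := K.2
  obtain ⟨q⟩ := nonempty_fiber_of_isConnected F (K.1 : C)
  obtain ⟨P, p, hp⟩ := exists_component_mem_range F (F.map (K.1.arrow ≫ g) q)
  haveI := P.2
  let r : F.obj (pullback (K.1.arrow ≫ g) P.1.arrow) :=
    (fiberPullbackEquiv F (K.1.arrow ≫ g) P.1.arrow).symm ⟨(q, p), hp.symm⟩
  have hni : IsInitial (pullback (K.1.arrow ≫ g) P.1.arrow) → False := not_initial_of_inhabited F r
  haveI : IsIso (pullback.fst (K.1.arrow ≫ g) P.1.arrow) := IsConnected.noTrivialComponent _ _ hni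
  refine ⟨P, inv (pullback.fst (K.1.arrow ≫ g) P.1.arrow) ≫ pullback.snd _ _, ?_⟩
  rw [Category.assoc, ← pullback.condition, IsIso.inv_hom_id_assoc]

/-- … and that component is unique. [cite: MochizukiSemiAnbd2006, Def. 2.2(i) p.23] -/
theorem component_factor_unique {Y S : C} (g : Y ⟶ S) (K : π₀Obj Y) {P P' : π₀Obj S}
    (k : (K.1 : C) ⟶ (P.1 : C)) (hk : k ≫ P.1.arrow = K.1.arrow ≫ g)
    (k' : (K.1 : C) ⟶ (P'.1 : C)) (hk' : k' ≫ P'.1.arrow = K.1.arrow ≫ g) : P = P' := by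
  let F := GaloisCategory.getFiberFunctor C
  haveI := K.2
  obtain ⟨q⟩ := nonempty_fiber_of_isConnected F (K.1 : C)
  refine component_eq_of_mem_range F P P' (x := F.map (K.1.arrow ≫ g) q) ⟨F.map k q, ?_⟩
    ⟨F.map k' q, ?_⟩
  · rw [← FintypeCat.comp_apply, ← F.map_comp, hk]
  · rw [← FintypeCat.comp_apply, ← F.map_comp, hk']

/-- The component under, as a function (by choice). [cite: MochizukiSemiAnbd2006, Def. 2.2(i) p.23] -/
noncomputable def componentUnder {Y S : C} (g : Y ⟶ S) (K : π₀Obj Y) : π₀Obj S :=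
  (exists_component_factor g K).choose

/-- The defining factorisation of `componentUnder`. [cite: MochizukiSemiAnbd2006, Def. 2.2(i) p.23] -/
theorem exists_factor_componentUnder {Y S : C} (g : Y ⟶ S) (K : π₀Obj Y) :
    ∃ k : (K.1 : C) ⟶ ((componentUnder g K).1 : C), k ≫ (componentUnder g K).1.arrow = K.1.arrow ≫ g :=
  (exists_component_factor g K).choose_spec

/-- Characterisation of `componentUnder` by any factorisation. [cite: MochizukiSemiAnbd2006, Def. 2.2(i) p.23] -/
theorem componentUnder_eq {Y S : C} (g : Y ⟶ S) (K : π₀Obj Y) {P : π₀Obj S}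
    (k : (K.1 : C) ⟶ (P.1 : C)) (hk : k ≫ P.1.arrow = K.1.arrow ≫ g) : componentUnder g K = P := by
  obtain ⟨k₀, hk₀⟩ := exists_factor_componentUnder g K
  exact component_factor_unique g K k₀ hk₀ k hk

end ComponentUnder

/-! ### Components read back through an equivalence `C_{/P} ⥤ D` -/

section ReadBack

variable {C : Type u₁} [Category.{v₁} C] [GaloisCategory C] {D : Type u₂} [Category.{v₂} D]
  {P : C} (α : Over P ⥤ D) [α.IsEquivalence] (Y : Over P)

/-- `α⁻¹ K ∈ C_{/P}` for a connected component `K ⊆ α Y`. [cite: MochizukiSemiAnbd2006, Def. 2.2(i) p.23] -/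
noncomputable def readBack (K : π₀Obj (α.obj Y)) : Over P := α.asEquivalence.inverse.obj (K.1 : D)

/-- `α⁻¹ K → α⁻¹ α Y ≅ Y`. [cite: MochizukiSemiAnbd2006, Def. 2.2(i) p.23] -/
noncomputable def readBackHom (K : π₀Obj (α.obj Y)) : readBack α Y K ⟶ Y :=
  α.asEquivalence.inverse.map K.1.arrow ≫ α.asEquivalence.unitIso.inv.app Y

/-- `α⁻¹ K → Y` is a monomorphism. [cite: MochizukiSemiAnbd2006, Def. 2.2(i) p.23] -/
instance mono_readBackHom (K : π₀Obj (α.obj Y)) : Mono (readBackHom α Y K) := by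
  unfold readBackHom
  haveI : Mono (α.asEquivalence.inverse.map K.1.arrow) := α.asEquivalence.inverse.map_mono _
  exact mono_comp _ _

omit [GaloisCategory C] in
/-- `α (α⁻¹ K → Y)` is `K ↪ α Y` up to the counit. [cite: MochizukiSemiAnbd2006, Def. 2.2(i) p.23] -/
theorem map_readBackHom (K : π₀Obj (α.obj Y)) :
    α.map (readBackHom α Y K) = α.asEquivalence.counitIso.hom.app (K.1 : D) ≫ K.1.arrow := by
  have h := α.asEquivalence.counitIso.hom.naturality K.1.arrow
  have h2 := α.asEquivalence.counit_app_functor Y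
  change α.map (α.asEquivalence.inverse.map K.1.arrow) ≫
      α.asEquivalence.counitIso.hom.app (α.obj Y) = _ ≫ K.1.arrow at h
  change α.asEquivalence.counitIso.hom.app (α.obj Y) = α.map (α.asEquivalence.unitIso.inv.app Y) at h2
  unfold readBackHom
  rw [Functor.map_comp, ← h2, h]

/-- The underlying object of `α⁻¹ K` is connected. [cite: MochizukiSemiAnbd2006, Def. 2.2(i) p.23] -/
theorem isConnected_readBack_left (K : π₀Obj (α.obj Y)) : IsConnected (readBack α Y K).left := by
  haveI := K.2
  haveI : IsConnected (readBack α Y K) :=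
    isConnected_map_equivalence α.asEquivalence.symm (K.1 : D)
  exact Over.isConnected_left _

variable {Z : C} (m : Y.left ⟶ Z) [Mono m]

/-- **The component of `Z` named by `K`**: `(α⁻¹ K).left ↪ Y.left ↪ Z`.
[cite: MochizukiSemiAnbd2006, Def. 2.2(i) p.23] -/
noncomputable def componentIn (K : π₀Obj (α.obj Y)) : π₀Obj Z :=
  ⟨Subobject.mk ((readBackHom α Y K).left ≫ m),
    haveI := isConnected_readBack_left α Y K
    isConnected_of_iso (Subobject.underlyingIso ((readBackHom α Y K).left ≫ m)).symm⟩

/-- The component named by `K` lies inside `m`. [cite: MochizukiSemiAnbd2006, Def. 2.2(i) p.23] -/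
theorem componentIn_le (K : π₀Obj (α.obj Y)) : (componentIn α Y m K).1 ≤ Subobject.mk m :=
  Subobject.mk_le_mk_of_comm (readBackHom α Y K).left rfl

/-- The arrow of the component named by `K`, through its underlying isomorphism with `(α⁻¹ K).left`.
[cite: MochizukiSemiAnbd2006, Def. 2.2(i) p.23] -/
theorem underlyingIso_inv_componentIn_arrow (K : π₀Obj (α.obj Y)) :
    (Subobject.underlyingIso ((readBackHom α Y K).left ≫ m)).inv ≫ (componentIn α Y m K).1.arrow =
      (readBackHom α Y K).left ≫ m :=
  Subobject.underlyingIso_arrow _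

/-- **Injectivity.** Distinct components of `α Y` name distinct components of `Z`.
[cite: MochizukiSemiAnbd2006, Def. 2.2(i) p.23] -/
theorem componentIn_injective : Function.Injective (componentIn α Y m) := by
  intro K₁ K₂ hK
  have hmk : Subobject.mk ((readBackHom α Y K₁).left ≫ m) =
      Subobject.mk ((readBackHom α Y K₂).left ≫ m) := congrArg Subtype.val hK
  -- the isomorphism of the underlying objects over `Z`, hence over `Y.left`, hence over `Y` in `C_{/P}`
  let e := Subobject.isoOfMkEqMk _ _ hmk
  have he : e.hom ≫ (readBackHom α Y K₂).left ≫ m = (readBackHom α Y K₁).left ≫ m :=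
    Subobject.ofMkLEMk_comp hmk.le
  have he' : e.hom ≫ (readBackHom α Y K₂).left = (readBackHom α Y K₁).left := by
    rw [← cancel_mono m, Category.assoc, he]
  let e' : readBack α Y K₁ ⟶ readBack α Y K₂ := Over.homMk e.hom (by
    have w₁ := Over.w (readBackHom α Y K₁)
    have w₂ := Over.w (readBackHom α Y K₂)
    rw [← w₁, ← he', Category.assoc, w₂])
  have he'' : e' ≫ readBackHom α Y K₂ = readBackHom α Y K₁ := by ext; exact he'
  -- apply `α` and cancel the counit
  have key : ∀ {L₁ L₂ : π₀Obj (α.obj Y)} (g : readBack α Y L₁ ⟶ readBack α Y L₂),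
      g ≫ readBackHom α Y L₂ = readBackHom α Y L₁ → L₁.1 ≤ L₂.1 := by
    intro L₁ L₂ g hg
    refine Subobject.le_of_comm
      (α.asEquivalence.counitIso.inv.app (L₁.1 : D) ≫ α.map g ≫
        α.asEquivalence.counitIso.hom.app (L₂.1 : D)) ?_
    have h₂ := map_readBackHom α Y L₂
    have h₁ := map_readBackHom α Y L₁
    calc (α.asEquivalence.counitIso.inv.app (L₁.1 : D) ≫ α.map g ≫
          α.asEquivalence.counitIso.hom.app (L₂.1 : D)) ≫ L₂.1.arrow
        = α.asEquivalence.counitIso.inv.app (L₁.1 : D) ≫ α.map g ≫ α.map (readBackHom α Y L₂) := by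
          rw [h₂, Category.assoc, Category.assoc]
      _ = α.asEquivalence.counitIso.inv.app (L₁.1 : D) ≫ α.map (readBackHom α Y L₁) := by
          rw [← Functor.map_comp, hg]
      _ = L₁.1.arrow := by rw [h₁, Iso.inv_hom_id_app_assoc]
  have hle : K₁.1 ≤ K₂.1 := key e' he''
  -- symmetric
  let f := Subobject.isoOfMkEqMk _ _ hmk.symm
  have hf : f.hom ≫ (readBackHom α Y K₁).left ≫ m = (readBackHom α Y K₂).left ≫ m :=
    Subobject.ofMkLEMk_comp hmk.symm.le
  have hf' : f.hom ≫ (readBackHom α Y K₁).left = (readBackHom α Y K₂).left := by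
    rw [← cancel_mono m, Category.assoc, hf]
  let f' : readBack α Y K₂ ⟶ readBack α Y K₁ := Over.homMk f.hom (by
    have w₁ := Over.w (readBackHom α Y K₁)
    have w₂ := Over.w (readBackHom α Y K₂)
    rw [← w₂, ← hf', Category.assoc, w₁])
  have hf'' : f' ≫ readBackHom α Y K₁ = readBackHom α Y K₂ := by ext; exact hf'
  have hge : K₂.1 ≤ K₁.1 := key f' hf''
  exact Subtype.ext (le_antisymm hle hge)

/-- **Surjectivity.** Every connected component of `Z` lying inside `m` is named by a component of
`α Y`: lift it to a subobject of `Y` in `C_{/P}` (connected there since connected underneath) and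
apply `α`. [cite: MochizukiSemiAnbd2006, Def. 2.2(i) p.23] -/
theorem exists_componentIn_eq (K₀ : π₀Obj Z) (h : K₀.1 ≤ Subobject.mk m) :
    ∃ K : π₀Obj (α.obj Y), componentIn α Y m K = K₀ := by
  haveI := K₀.2
  -- `K₀` as a subobject of `Y` over `P`
  let k : (K₀.1 : C) ⟶ Y.left := Subobject.ofLEMk _ m h
  have hk : k ≫ m = K₀.1.arrow := Subobject.ofLEMk_comp h
  haveI : Mono k := mono_of_mono_fac hk
  let K₀' : Over P := Over.mk (k ≫ Y.hom)
  let j : K₀' ⟶ Y := Over.homMk k rfl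
  haveI : Mono j := (Over.forget P).mono_of_mono_map (by change Mono k; infer_instance)
  haveI : IsConnected K₀'.left := K₀.2
  haveI : IsConnected K₀' := Over.isConnected_of_isConnected_left K₀'
  haveI : IsConnected (α.obj K₀') := isConnected_map_equivalence α.asEquivalence K₀'
  haveI : Mono (α.map j) := α.map_mono j
  haveI : IsConnected (Subobject.mk (α.map j) : D) :=
    isConnected_of_iso (Subobject.underlyingIso (α.map j)).symm
  refine ⟨⟨Subobject.mk (α.map j), inferInstance⟩, Subtype.ext ?_⟩
  -- compare the two monomorphisms into `Z` through an isomorphism of their sources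
  change Subobject.mk ((readBackHom α Y ⟨Subobject.mk (α.map j), inferInstance⟩).left ≫ m) = K₀.1
  have hnat : α.asEquivalence.inverse.map (α.map j) ≫ α.asEquivalence.unitIso.inv.app Y =
      α.asEquivalence.unitIso.inv.app K₀' ≫ j := α.asEquivalence.unitIso.inv.naturality j
  let ι : readBack α Y ⟨Subobject.mk (α.map j), inferInstance⟩ ≅ K₀' :=
    α.asEquivalence.inverse.mapIso (Subobject.underlyingIso (α.map j)) ≪≫
      α.asEquivalence.unitIso.symm.app K₀'
  have hι : ι.hom ≫ j = readBackHom α Y ⟨Subobject.mk (α.map j), inferInstance⟩ := by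
    change (α.asEquivalence.inverse.map (Subobject.underlyingIso (α.map j)).hom ≫
        α.asEquivalence.unitIso.inv.app K₀') ≫ j =
      α.asEquivalence.inverse.map (Subobject.mk (α.map j)).arrow ≫ α.asEquivalence.unitIso.inv.app Y
    rw [← Subobject.underlyingIso_hom_comp_eq_mk (α.map j), Functor.map_comp, Category.assoc,
      Category.assoc, hnat]
  calc Subobject.mk ((readBackHom α Y ⟨Subobject.mk (α.map j), inferInstance⟩).left ≫ m)
      = Subobject.mk (k ≫ m) := by
        refine Subobject.mk_eq_mk_of_comm _ _ ((Over.forget P).mapIso ι) ?_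
        change ι.hom.left ≫ k ≫ m = _
        rw [← Category.assoc]
        congr 1
        exact congrArg CommaMorphism.left hι
    _ = Subobject.mk K₀.1.arrow := Subobject.mk_eq_mk_of_comm _ _ (Iso.refl _) (by rw [Iso.refl_hom, Category.id_comp, hk])
    _ = K₀.1 := Subobject.mk_arrow _

/-- **The constituent clause at the component named by `K`**: `(P × −)`, then `α`, then `(K × −)` is
`(componentIn K × −)` followed by an equivalence `C_{/componentIn K} ⥤ D_{/K}` (iterated slices through
`α`, transported along `componentIn K ≅ (α⁻¹ K).left`). [cite: MochizukiSemiAnbd2006, Def. 2.2(i) p.23] -/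
theorem exists_sliceEquiv_componentIn [HasBinaryProducts D] (K : π₀Obj (α.obj Y)) :
    ∃ E : Over ((componentIn α Y m K).1 : C) ⥤ Over (K.1 : D), E.IsEquivalence ∧
      Nonempty (Over.star P ⋙ α ⋙ Over.star (K.1 : D) ≅ Over.star ((componentIn α Y m K).1 : C) ⋙ E) := by
  let u : ((componentIn α Y m K).1 : C) ≅ (readBack α Y K).left :=
    Subobject.underlyingIso ((readBackHom α Y K).left ≫ m)
  let G : Over (K.1 : D) ⥤ Over (α.inv.obj (K.1 : D)).left :=
    Over.post α.inv ⋙ ((α.inv.obj (K.1 : D)).iteratedSliceEquiv).functor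
  haveI : G.IsEquivalence := Functor.isEquivalence_trans _ _
  obtain ⟨σ⟩ := nonempty_starMapIso u
  refine ⟨(Over.mapIso u).functor ⋙ G.inv, Functor.isEquivalence_trans _ _, ⟨?_⟩⟩
  exact SemiGraphOfAnabelioids.starEquivStarIso P α (K.1 : D) ≪≫
    Functor.isoWhiskerRight σ.symm G.inv ≪≫ Functor.associator _ _ _

end ReadBack

end Literature.AnabelianGeometry.SemiGraphs
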